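import Summits.CriticalPhenomena.PercolationContinuityZ3.Theorems.PercNearOneGluingNoHeavyLowerTailKnQuestion8CoefficientwiseCoreClassClusters
import HarnessLib

/-!
# Core class `N(x) = N(z) = {a, b}`: peeling the two terminals (the wall sum as a sum over colourings of the middle graph)

Support file (`--supports stmt-CriticalPhenomena-4575`, closed), prover `prim-cplus-coupling` (gen 29).  No definitions, no notations, no named facts,
no sorries; standard axioms.  Memo `prim-cplus-coupling/A5-COUPLING-gen29.md` §3.4; clusters `…CoefficientwiseCoreClassClusters.lean`.

Setting (prim-lf-2's CORE CLASS at `|N| = 2`, memo `prim-cplus-coupling/A5-COUPLING-gen29.md` §3.4): a finite multigraph `ends : ι → Sym2 V` whose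
edge set is `E₀ = E_H ∪ {ixa, ixb, iza, izb}` with `ends ixa = s(x,a)`, `ends ixb = s(x,b)`, `ends iza = s(z,a)`, `ends izb = s(z,b)` and no edge of `E_H`
at `x` or `z`: the terminals `x, z` have the common neighbourhood `{a, b}` through single edges, the middle graph `H = (V, E_H)` is arbitrary.
Colourings `s ⊆ E₀` (red) / `E₀ ∖ s` (blue), `K = C_x(s)`, `L = C_x(E₀ ∖ s)`, wall `T = {z ∉ K} ∩ {z ∉ L}`; `C_v(ω) = openCluster (ends '' ω) v`.
For an ARBITRARY function `Φ` of the pair `(K, L)`: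
* `Coefficientwise.coreClass_sum_one` — the wall colourings with `xa` red, `xb` blue are exactly `ω ∪ {ixa, izb}` with `ω ⊆ E_H` in the wall event
  of `(H; a, b)` (no monochromatic `a–b` path in `H`), and there `K = {x} ∪ C_a(ω)`, `L = {x} ∪ C_b(E_H ∖ ω)`:
  `Σ_{s ∈ T, ixa ∈ s, ixb ∉ s} Φ(K, L) = Σ_{ω ⊆ E_H : b ∉ C_a(ω), b ∉ C_a(E_H∖ω)} Φ({x} ∪ C_a ω, {x} ∪ C_b(E_H ∖ ω))`;
* `Coefficientwise.coreClass_sum_two` — the wall colourings with `xa, xb` red are exactly `ω ∪ {ixa, ixb}`, `ω ⊆ E_H`, with `K = {x} ∪ C_a ω ∪ C_b ω`, `L = {x}`: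
  `Σ_{s ∈ T, ixa, ixb ∈ s} Φ(K, L) = Σ_{ω ⊆ E_H} Φ({x} ∪ C_a ω ∪ C_b ω, {x})`.
(The two remaining parts are these with `a ↔ b` resp. with the colours swapped.)  Together: `Σ_T f(K)(g(K) − g(L))` for `f({x}) = 0` equals the core-class
kernel of `…CoefficientwiseCoreClassKernel.lean` at `f_H(S) = f({x} ∪ S)`, `g_H(S) = g({x} ∪ S)`.
[cite: KozmaNitzan2024, Questions 8–9 (§5.5 p. 36) (context: the Question-8 pocket covariance programme)]
-/

namespace Summit.CriticalPhenomena.PercolationContinuityZ3.Theorems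

open Finset Literature.Probability.Percolation

namespace Coefficientwise

variable {ι V : Type*}
open Classical in
/-- **Peeling, mixed part.**  In the core class (edges `E₀ = E_H ∪ {ixa, ixb, iza, izb}` as in the file header), the wall colourings with `xa` red and
`xb` blue are exactly `ω ∪ {ixa, izb}` with `ω ⊆ E_H` in the wall event of `(H; a, b)`, and there `K = {x} ∪ C_a(ω)`, `L = {x} ∪ C_b(E_H ∖ ω)`:
for every `Φ`, `Σ_{s ∈ T, ixa ∈ s, ixb ∉ s} Φ(K, L) = Σ_{ω ⊆ E_H : b ∉ C_a(ω), b ∉ C_a(E_H∖ω)} Φ({x} ∪ C_a ω, {x} ∪ C_b(E_H ∖ ω))`.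
[cite: KozmaNitzan2024, §5.5 (context only)] -/
theorem coreClass_sum_one (ends : ι → Sym2 V) (EH E₀ : Finset ι) {x z a b : V} {ixa ixb iza izb : ι}
    (hxa : ends ixa = s(x, a)) (hxb : ends ixb = s(x, b)) (hza : ends iza = s(z, a)) (hzb : ends izb = s(z, b))
    (hH : ∀ i ∈ EH, x ∉ ends i ∧ z ∉ ends i) (hE₀ : ∀ i, i ∈ E₀ ↔ i ∈ EH ∨ i = ixa ∨ i = ixb ∨ i = iza ∨ i = izb)
    (hnot : ixa ∉ EH ∧ ixb ∉ EH ∧ iza ∉ EH ∧ izb ∉ EH)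
    (hd : ixa ≠ ixb ∧ ixa ≠ iza ∧ ixa ≠ izb ∧ ixb ≠ iza ∧ ixb ≠ izb ∧ iza ≠ izb)
    (hxz : x ≠ z) (hxa' : x ≠ a) (hxb' : x ≠ b) (hza' : z ≠ a) (hzb' : z ≠ b)
    (Φ : Set V → Set V → ℝ) :
    ∑ s ∈ E₀.powerset.filter (fun s : Finset ι => (z ∉ openCluster (ends '' (↑s : Set ι)) x ∧ z ∉ openCluster (ends '' (↑(E₀ \ s) : Set ι)) x)
        ∧ ixa ∈ s ∧ ixb ∉ s), Φ (openCluster (ends '' (↑s : Set ι)) x) (openCluster (ends '' (↑(E₀ \ s) : Set ι)) x) =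
    ∑ ω ∈ EH.powerset.filter (fun ω : Finset ι => b ∉ openCluster (ends '' (↑ω : Set ι)) a ∧ b ∉ openCluster (ends '' (↑(EH \ ω) : Set ι)) a),
        Φ ({x} ∪ openCluster (ends '' (↑ω : Set ι)) a) ({x} ∪ openCluster (ends '' (↑(EH \ ω) : Set ι)) b) := by
  obtain ⟨hna, hnb, hnza, hnzb⟩ := hnot
  obtain ⟨d1, d2, d3, d4, d5, d6⟩ := hd
  -- membership bookkeeping in `E₀`
  have hsubE : ∀ s, s ⊆ E₀ → ∀ i ∈ s, i ∈ EH ∨ i = ixa ∨ i = ixb ∨ i = iza ∨ i = izb := fun s hs i hi => (hE₀ i).mp (hs hi)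
  have hsubE' : ∀ s, s ⊆ E₀ → ∀ i ∈ E₀ \ s, i ∈ EH ∨ i = ixb ∨ i = ixa ∨ i = izb ∨ i = iza := by
    intro s _ i hi
    have := (hE₀ i).mp (Finset.mem_sdiff.mp hi).1
    tauto
  have hH' : ∀ i ∈ EH, x ∉ ends i := fun i hi => (hH i hi).1
  -- reachability symmetry between `a` and `b`
  have comm : ∀ (t : Finset ι), b ∈ openCluster (ends '' (↑t : Set ι)) a ↔ a ∈ openCluster (ends '' (↑t : Set ι)) b :=
    fun t => mem_openCluster_comm ends t a b
  -- the forward facts for a member `s` of the part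
  have fwd : ∀ s, s ⊆ E₀ → z ∉ openCluster (ends '' (↑s : Set ι)) x → z ∉ openCluster (ends '' (↑(E₀ \ s) : Set ι)) x →
      ixa ∈ s → ixb ∉ s →
      iza ∉ s ∧ izb ∈ s ∧ b ∉ openCluster (ends '' (↑(s ∩ EH) : Set ι)) a ∧ b ∉ openCluster (ends '' (↑(EH \ (s ∩ EH)) : Set ι)) a := by
    intro s hs hz1 hz2 h1 h2
    have h3 : iza ∉ s := fun h => hz1 (coreClass_reach_z ends s hxa hza h1 h)
    have h4 : izb ∈ s := by
      by_contra h
      have hb' : ixb ∈ E₀ \ s := Finset.mem_sdiff.mpr ⟨(hE₀ ixb).mpr (Or.inr (Or.inr (Or.inl rfl))), h2⟩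
      have hzb'' : izb ∈ E₀ \ s := Finset.mem_sdiff.mpr ⟨(hE₀ izb).mpr (Or.inr (Or.inr (Or.inr (Or.inr rfl)))), h⟩
      exact hz2 (coreClass_reach_z ends (E₀ \ s) hxb hzb hb' hzb'')
    have h5 : b ∉ openCluster (ends '' (↑(s ∩ EH) : Set ι)) a := by
      intro hb
      have ha : a ∈ openCluster (ends '' (↑s : Set ι)) x := mem_openCluster_of_edge ends h1 hxa (mem_openCluster_self _ _)
      have hb2 : b ∈ openCluster (ends '' (↑s : Set ι)) x :=
        SimpleGraph.Reachable.trans ha (openCluster_image_mono ends Finset.inter_subset_left a hb)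
      exact hz1 (mem_openCluster_of_edge ends h4 (hzb.trans Sym2.eq_swap) hb2)
    have h6 : b ∉ openCluster (ends '' (↑(EH \ (s ∩ EH)) : Set ι)) a := by
      intro hb
      have ha2 : a ∈ openCluster (ends '' (↑(EH \ (s ∩ EH)) : Set ι)) b := (comm _).mp hb
      have hbL : b ∈ openCluster (ends '' (↑(E₀ \ s) : Set ι)) x :=
        mem_openCluster_of_edge ends (Finset.mem_sdiff.mpr ⟨(hE₀ ixb).mpr (Or.inr (Or.inr (Or.inl rfl))), h2⟩) hxb (mem_openCluster_self _ _)
      have hsub : EH \ (s ∩ EH) ⊆ E₀ \ s := by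
        intro i hi
        rw [Finset.mem_sdiff, Finset.mem_inter] at hi
        exact Finset.mem_sdiff.mpr ⟨(hE₀ i).mpr (Or.inl hi.1), fun h => hi.2 ⟨h, hi.1⟩⟩
      have haL : a ∈ openCluster (ends '' (↑(E₀ \ s) : Set ι)) x := SimpleGraph.Reachable.trans hbL (openCluster_image_mono ends hsub b ha2)
      exact hz2 (mem_openCluster_of_edge ends (Finset.mem_sdiff.mpr ⟨(hE₀ iza).mpr (Or.inr (Or.inr (Or.inr (Or.inl rfl)))), h3⟩)
        (hza.trans Sym2.eq_swap) haL)
    exact ⟨h3, h4, h5, h6⟩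
  -- clusters of `ω ∪ {ixa, izb}` for `ω` in the wall event of `H`
  have hEHz : ∀ (t : Finset ι), t ⊆ EH → ∀ v, v ≠ z → z ∉ openCluster (ends '' (↑t : Set ι)) v :=
    fun t ht v hv => not_mem_openCluster_of_no_edge_at ends t hv (fun i hi => (hH i (ht hi)).2)
  have clusK : ∀ ω, ω ⊆ EH → b ∉ openCluster (ends '' (↑ω : Set ι)) a →
      openCluster (ends '' (↑(insert ixa (insert izb ω)) : Set ι)) x = {x} ∪ openCluster (ends '' (↑ω : Set ι)) a := by
    intro ω hω hb
    have hint : insert ixa (insert izb ω) ∩ EH = ω := by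
      ext i; simp only [Finset.mem_inter, Finset.mem_insert]
      constructor
      · rintro ⟨h | h | h, hE⟩
        · exact absurd hE (h ▸ hna)
        · exact absurd hE (h ▸ hnzb)
        · exact h
      · exact fun h => ⟨Or.inr (Or.inr h), hω h⟩
    have key := coreClass_cluster_one ends EH (insert ixa (insert izb ω)) (x := x) (z := z) (a := a) (b := b)
      (ixa := ixa) (ixb := ixb) (iza := iza) (izb := izb) hxa hzb (Ne.symm hxz) (Ne.symm hxb') hza' hH
      (fun i hi => by
        simp only [Finset.mem_insert] at hi
        rcases hi with rfl | rfl | hi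
        · exact Or.inr (Or.inl rfl)
        · exact Or.inr (Or.inr (Or.inr (Or.inr rfl)))
        · exact Or.inl (hω hi))
      (Finset.mem_insert_self _ _)
      (by simp only [Finset.mem_insert, not_or]; exact ⟨fun h => d1 h.symm, fun h => d5 h, fun h => hnb (hω h)⟩)
      (by simp only [Finset.mem_insert, not_or]; exact ⟨fun h => d2 h.symm, fun h => d6 h, fun h => hnza (hω h)⟩)
      (by rw [hint]; exact hb)
    rw [key, hint]
  have clusL : ∀ ω, ω ⊆ EH → b ∉ openCluster (ends '' (↑(EH \ ω) : Set ι)) a →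
      openCluster (ends '' (↑(E₀ \ insert ixa (insert izb ω)) : Set ι)) x = {x} ∪ openCluster (ends '' (↑(EH \ ω) : Set ι)) b := by
    intro ω hω hb
    have hint : (E₀ \ insert ixa (insert izb ω)) ∩ EH = EH \ ω := by
      ext i; simp only [Finset.mem_inter, Finset.mem_sdiff, Finset.mem_insert, not_or, hE₀]
      constructor
      · rintro ⟨⟨_, _, _, hni⟩, hE⟩; exact ⟨hE, hni⟩
      · rintro ⟨hE, hni⟩
        exact ⟨⟨Or.inl hE, fun h => hna (h ▸ hE), fun h => hnzb (h ▸ hE), hni⟩, hE⟩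
    have ha' : a ∉ openCluster (ends '' (↑((E₀ \ insert ixa (insert izb ω)) ∩ EH) : Set ι)) b := by
      rw [hint]; exact fun h => hb ((comm _).mpr h)
    have key := coreClass_cluster_one ends EH (E₀ \ insert ixa (insert izb ω)) (x := x) (z := z) (a := b) (b := a)
      (ixa := ixb) (ixb := ixa) (iza := izb) (izb := iza) hxb hza (Ne.symm hxz) (Ne.symm hxa') hzb' hH
      (fun i hi => by
        have := hsubE' (insert ixa (insert izb ω)) (by
          intro j hj; simp only [Finset.mem_insert] at hj
          rcases hj with rfl | rfl | hj
          · exact (hE₀ _).mpr (Or.inr (Or.inl rfl))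
          · exact (hE₀ _).mpr (Or.inr (Or.inr (Or.inr (Or.inr rfl))))
          · exact (hE₀ _).mpr (Or.inl (hω hj))) i hi
        exact this)
      (by
        rw [Finset.mem_sdiff]; refine ⟨(hE₀ ixb).mpr (Or.inr (Or.inr (Or.inl rfl))), ?_⟩
        simp only [Finset.mem_insert, not_or]; exact ⟨fun h => d1 h.symm, fun h => d5 h, fun h => hnb (hω h)⟩)
      (fun h => (Finset.mem_sdiff.mp h).2 (Finset.mem_insert_self _ _))
      (fun h => (Finset.mem_sdiff.mp h).2 (Finset.mem_insert_of_mem (Finset.mem_insert_self _ _)))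
      ha'
    rw [key, hint]
  -- the bijection `s ↦ s ∩ E_H`, `ω ↦ ω ∪ {ixa, izb}`
  refine Finset.sum_nbij' (fun s : Finset ι => s ∩ EH) (fun ω : Finset ι => insert ixa (insert izb ω)) ?_ ?_ ?_ ?_ ?_
  · intro s hs
    rw [Finset.mem_filter, Finset.mem_powerset] at hs ⊢
    obtain ⟨hsE, ⟨hz1, hz2⟩, h1, h2⟩ := hs
    obtain ⟨-, -, h5, h6⟩ := fwd s hsE hz1 hz2 h1 h2
    exact ⟨Finset.inter_subset_right, h5, h6⟩
  · intro ω hω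
    rw [Finset.mem_filter, Finset.mem_powerset] at hω ⊢
    obtain ⟨hωE, hb1, hb2⟩ := hω
    refine ⟨?_, ⟨?_, ?_⟩, Finset.mem_insert_self _ _, ?_⟩
    · intro i hi
      simp only [Finset.mem_insert] at hi
      rcases hi with rfl | rfl | hi
      · exact (hE₀ _).mpr (Or.inr (Or.inl rfl))
      · exact (hE₀ _).mpr (Or.inr (Or.inr (Or.inr (Or.inr rfl))))
      · exact (hE₀ _).mpr (Or.inl (hωE hi))
    · rw [clusK ω hωE hb1]
      rintro (h | h)
      · exact hxz (Set.mem_singleton_iff.mp h).symm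
      · exact hEHz ω hωE a hza'.symm h
    · rw [clusL ω hωE hb2]
      rintro (h | h)
      · exact hxz (Set.mem_singleton_iff.mp h).symm
      · exact hEHz (EH \ ω) Finset.sdiff_subset b hzb'.symm h
    · simp only [Finset.mem_insert, not_or]
      exact ⟨fun h => d1 h.symm, fun h => d5 h, fun h => hnb (hωE h)⟩
  · intro s hs
    rw [Finset.mem_filter, Finset.mem_powerset] at hs
    obtain ⟨hsE, ⟨hz1, hz2⟩, h1, h2⟩ := hs
    obtain ⟨h3, h4, -, -⟩ := fwd s hsE hz1 hz2 h1 h2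
    ext i
    simp only [Finset.mem_insert, Finset.mem_inter]
    constructor
    · rintro (rfl | rfl | ⟨hi, -⟩)
      · exact h1
      · exact h4
      · exact hi
    · intro hi
      rcases hsubE s hsE i hi with hiH | rfl | rfl | rfl | rfl
      · exact Or.inr (Or.inr ⟨hi, hiH⟩)
      · exact Or.inl rfl
      · exact absurd hi h2
      · exact absurd hi h3
      · exact Or.inr (Or.inl rfl)
  · intro ω hω
    rw [Finset.mem_filter, Finset.mem_powerset] at hω
    ext i; simp only [Finset.mem_inter, Finset.mem_insert]
    constructor
    · rintro ⟨h | h | h, hE⟩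
      · exact absurd hE (h ▸ hna)
      · exact absurd hE (h ▸ hnzb)
      · exact h
    · exact fun h => ⟨Or.inr (Or.inr h), hω.1 h⟩
  · intro s hs
    rw [Finset.mem_filter, Finset.mem_powerset] at hs
    obtain ⟨hsE, ⟨hz1, hz2⟩, h1, h2⟩ := hs
    obtain ⟨h3, h4, h5, h6⟩ := fwd s hsE hz1 hz2 h1 h2
    have hs_eq : s = insert ixa (insert izb (s ∩ EH)) := by
      ext i
      simp only [Finset.mem_insert, Finset.mem_inter]
      constructor
      · intro hi
        rcases hsubE s hsE i hi with hiH | rfl | rfl | rfl | rfl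
        · exact Or.inr (Or.inr ⟨hi, hiH⟩)
        · exact Or.inl rfl
        · exact absurd hi h2
        · exact absurd hi h3
        · exact Or.inr (Or.inl rfl)
      · rintro (rfl | rfl | ⟨hi, -⟩)
        · exact h1
        · exact h4
        · exact hi
    have e1 := clusK (s ∩ EH) Finset.inter_subset_right h5
    have e2 := clusL (s ∩ EH) Finset.inter_subset_right h6
    rw [← hs_eq] at e1 e2
    rw [e1, e2]


open Classical in
/-- **Peeling, doubly red part.**  The wall colourings with `xa, xb` red are exactly `ω ∪ {ixa, ixb}`, `ω ⊆ E_H`, and there `K = {x} ∪ C_a(ω) ∪ C_b(ω)`,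
`L = {x}`: for every `Φ`, `Σ_{s ∈ T, ixa ∈ s, ixb ∈ s} Φ(K, L) = Σ_{ω ⊆ E_H} Φ({x} ∪ C_a ω ∪ C_b ω, {x})`. [cite: KozmaNitzan2024, §5.5 (context only)] -/
theorem coreClass_sum_two (ends : ι → Sym2 V) (EH E₀ : Finset ι) {x z a b : V} {ixa ixb iza izb : ι}
    (hxa : ends ixa = s(x, a)) (hxb : ends ixb = s(x, b)) (hza : ends iza = s(z, a)) (hzb : ends izb = s(z, b))
    (hH : ∀ i ∈ EH, x ∉ ends i ∧ z ∉ ends i) (hE₀ : ∀ i, i ∈ E₀ ↔ i ∈ EH ∨ i = ixa ∨ i = ixb ∨ i = iza ∨ i = izb)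
    (hnot : ixa ∉ EH ∧ ixb ∉ EH ∧ iza ∉ EH ∧ izb ∉ EH)
    (hd : ixa ≠ ixb ∧ ixa ≠ iza ∧ ixa ≠ izb ∧ ixb ≠ iza ∧ ixb ≠ izb ∧ iza ≠ izb)
    (hxz : x ≠ z) (hxa' : x ≠ a) (hxb' : x ≠ b) (hza' : z ≠ a) (hzb' : z ≠ b)
    (Φ : Set V → Set V → ℝ) :
    ∑ s ∈ E₀.powerset.filter (fun s : Finset ι => (z ∉ openCluster (ends '' (↑s : Set ι)) x ∧ z ∉ openCluster (ends '' (↑(E₀ \ s) : Set ι)) x)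
        ∧ ixa ∈ s ∧ ixb ∈ s), Φ (openCluster (ends '' (↑s : Set ι)) x) (openCluster (ends '' (↑(E₀ \ s) : Set ι)) x) =
    ∑ ω ∈ EH.powerset, Φ ({x} ∪ openCluster (ends '' (↑ω : Set ι)) a ∪ openCluster (ends '' (↑ω : Set ι)) b) {x} := by
  obtain ⟨hna, hnb, hnza, hnzb⟩ := hnot
  obtain ⟨d1, d2, d3, d4, d5, d6⟩ := hd
  have hsubE : ∀ s, s ⊆ E₀ → ∀ i ∈ s, i ∈ EH ∨ i = ixa ∨ i = ixb ∨ i = iza ∨ i = izb := fun s hs i hi => (hE₀ i).mp (hs hi)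
  -- no edge of `E₀` other than `ixa, ixb` meets `x`; none other than `iza, izb` meets `z`
  have hxi : ∀ i, i ∈ EH ∨ i = iza ∨ i = izb → x ∉ ends i := by
    rintro i (hi | rfl | rfl)
    · exact (hH i hi).1
    · rw [hza, Sym2.mem_iff, not_or]; exact ⟨hxz, hxa'⟩
    · rw [hzb, Sym2.mem_iff, not_or]; exact ⟨hxz, hxb'⟩
  have hzi : ∀ i, i ∈ EH ∨ i = ixa ∨ i = ixb → z ∉ ends i := by
    rintro i (hi | rfl | rfl)
    · exact (hH i hi).2
    · rw [hxa, Sym2.mem_iff, not_or]; exact ⟨hxz.symm, hza'⟩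
    · rw [hxb, Sym2.mem_iff, not_or]; exact ⟨hxz.symm, hzb'⟩
  have fwd : ∀ s, s ⊆ E₀ → z ∉ openCluster (ends '' (↑s : Set ι)) x → ixa ∈ s → ixb ∈ s → iza ∉ s ∧ izb ∉ s :=
    fun s _ hz1 h1 h2 => ⟨fun h => hz1 (coreClass_reach_z ends s hxa hza h1 h), fun h => hz1 (coreClass_reach_z ends s hxb hzb h2 h)⟩
  have hint : ∀ ω, ω ⊆ EH → insert ixa (insert ixb ω) ∩ EH = ω := by
    intro ω hω; ext i; simp only [Finset.mem_inter, Finset.mem_insert]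
    constructor
    · rintro ⟨h | h | h, hE⟩
      · exact absurd hE (h ▸ hna)
      · exact absurd hE (h ▸ hnb)
      · exact h
    · exact fun h => ⟨Or.inr (Or.inr h), hω h⟩
  have clusK : ∀ ω, ω ⊆ EH → openCluster (ends '' (↑(insert ixa (insert ixb ω)) : Set ι)) x =
      {x} ∪ openCluster (ends '' (↑ω : Set ι)) a ∪ openCluster (ends '' (↑ω : Set ι)) b := by
    intro ω hω
    have key := coreClass_cluster_two ends EH (insert ixa (insert ixb ω)) (x := x) (a := a) (b := b)
      (ixa := ixa) (ixb := ixb) (iza := iza) (izb := izb) hxa hxb (fun i hi => (hH i hi).1)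
      (fun i hi => by
        simp only [Finset.mem_insert] at hi
        rcases hi with rfl | rfl | hi
        · exact Or.inr (Or.inl rfl)
        · exact Or.inr (Or.inr (Or.inl rfl))
        · exact Or.inl (hω hi))
      (Finset.mem_insert_self _ _) (Finset.mem_insert_of_mem (Finset.mem_insert_self _ _))
      (by simp only [Finset.mem_insert, not_or]; exact ⟨fun h => d2 h.symm, fun h => d4 h.symm, fun h => hnza (hω h)⟩)
      (by simp only [Finset.mem_insert, not_or]; exact ⟨fun h => d3 h.symm, fun h => d5 h.symm, fun h => hnzb (hω h)⟩)
    rw [key, hint ω hω]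
  have clusL : ∀ ω, ω ⊆ EH → openCluster (ends '' (↑(E₀ \ insert ixa (insert ixb ω)) : Set ι)) x = {x} := by
    intro ω hω
    refine openCluster_eq_singleton_of_no_edge_at ends _ (fun i hi => hxi i ?_)
    rw [Finset.mem_sdiff, Finset.mem_insert, Finset.mem_insert, not_or, not_or] at hi
    rcases (hE₀ i).mp hi.1 with h | h | h | h | h
    · exact Or.inl h
    · exact absurd h hi.2.1
    · exact absurd h hi.2.2.1
    · exact Or.inr (Or.inl h)
    · exact Or.inr (Or.inr h)
  refine Finset.sum_nbij' (fun s : Finset ι => s ∩ EH) (fun ω : Finset ι => insert ixa (insert ixb ω)) ?_ ?_ ?_ ?_ ?_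
  · intro s _
    exact Finset.mem_powerset.mpr Finset.inter_subset_right
  · intro ω hω
    rw [Finset.mem_powerset] at hω
    rw [Finset.mem_filter, Finset.mem_powerset]
    refine ⟨?_, ⟨?_, ?_⟩, Finset.mem_insert_self _ _, Finset.mem_insert_of_mem (Finset.mem_insert_self _ _)⟩
    · intro i hi
      simp only [Finset.mem_insert] at hi
      rcases hi with rfl | rfl | hi
      · exact (hE₀ _).mpr (Or.inr (Or.inl rfl))
      · exact (hE₀ _).mpr (Or.inr (Or.inr (Or.inl rfl)))
      · exact (hE₀ _).mpr (Or.inl (hω hi))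
    · refine not_mem_openCluster_of_no_edge_at ends _ hxz (fun i hi => hzi i ?_)
      simp only [Finset.mem_insert] at hi
      rcases hi with rfl | rfl | hi
      · exact Or.inr (Or.inl rfl)
      · exact Or.inr (Or.inr rfl)
      · exact Or.inl (hω hi)
    · rw [clusL ω hω, Set.mem_singleton_iff]; exact fun h => hxz h.symm
  · intro s hs
    rw [Finset.mem_filter, Finset.mem_powerset] at hs
    obtain ⟨hsE, ⟨hz1, -⟩, h1, h2⟩ := hs
    obtain ⟨h3, h4⟩ := fwd s hsE hz1 h1 h2
    ext i
    simp only [Finset.mem_insert, Finset.mem_inter]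
    constructor
    · rintro (rfl | rfl | ⟨hi, -⟩)
      · exact h1
      · exact h2
      · exact hi
    · intro hi
      rcases hsubE s hsE i hi with hiH | rfl | rfl | rfl | rfl
      · exact Or.inr (Or.inr ⟨hi, hiH⟩)
      · exact Or.inl rfl
      · exact Or.inr (Or.inl rfl)
      · exact absurd hi h3
      · exact absurd hi h4
  · intro ω hω
    rw [Finset.mem_powerset] at hω
    exact hint ω hω
  · intro s hs
    rw [Finset.mem_filter, Finset.mem_powerset] at hs
    obtain ⟨hsE, ⟨hz1, -⟩, h1, h2⟩ := hs
    obtain ⟨h3, h4⟩ := fwd s hsE hz1 h1 h2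
    have hs_eq : s = insert ixa (insert ixb (s ∩ EH)) := by
      ext i
      simp only [Finset.mem_insert, Finset.mem_inter]
      constructor
      · intro hi
        rcases hsubE s hsE i hi with hiH | rfl | rfl | rfl | rfl
        · exact Or.inr (Or.inr ⟨hi, hiH⟩)
        · exact Or.inl rfl
        · exact Or.inr (Or.inl rfl)
        · exact absurd hi h3
        · exact absurd hi h4
      · rintro (rfl | rfl | ⟨hi, -⟩)
        · exact h1
        · exact h2
        · exact hi
    have e1 := clusK (s ∩ EH) Finset.inter_subset_right
    have e2 := clusL (s ∩ EH) Finset.inter_subset_right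
    rw [← hs_eq] at e1 e2
    rw [e1, e2]

end Coefficientwise

end Summit.CriticalPhenomena.PercolationContinuityZ3.Theorems
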